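import Summits.QuantumFields.YangMills.Theorems.BalabanUVNodesRateCarriersOfRecord13
import Literature.MathematicalPhysics.QuantumFieldTheory.Balaban1983to89.Node00.U3OfKernels
import Literature.MathematicalPhysics.QuantumFieldTheory.Balaban1983to89.B12Decay510Window
import Literature.MathematicalPhysics.QuantumFieldTheory.Balaban1983to89.Beta.RemainderConstNumerals

/-!
# BalabanUVNodes ∕ node N22 = NE9 — module J94: THE (0.26) CENSUS IS FLOOR-FREE ON THE KERNEL CARRIER OF RECORD
# (the repair «r4» of director-ym №276 «ONE LETTER ℓ.κ, TWO PRINTED RATES», certified at the N22 ∕ N18 slot)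

Cell `pub-ymgap`, HUMAN RULING D-0062 (Track A), R134 seat `pub-ymgap-dag-n22-c` (strategy s1), generation 25, module J94.  THEOREMS ONLY (no `def`,
no `sorry`, standard axioms); `--kind proof --supports stmt-QuantumFields-27366 --as helper` (K3⁸), COUNT-NEUTRAL.  Imports the Stage-13 bundle module
`…RateCarriersOfRecord13` (`YMDAG.UVSplit.u3OfRecord₁₃`), NODE 00's `U3OfKernels` (the kernel carrier `carriers` and the objects of record
`objectsOfRecord₁₃`) `B12Decay510Window` (the lattice constant `K₁ d a = Σ'_{z ∈ ℤᵈ} e^{−a|z|₁}`) and `Beta.RemainderConstNumerals` (its closed form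
`K₁_eq_pow : K₁ d a = ((1 + e^{−a}) ∕ (1 − e^{−a}))^d` and `K₁_le_pow : K₁ d a ≤ (1 + 2∕a)^d`, cell pub-balaban — imported BY NAME).  Nothing re-declared.

WHY (first-hand reading, 2026-08-29, bus `pub-ymgap/INBOX.md` I.46770).  Director-ym №276 booked a LOCATED SIZE on the K3⁸ docket: the census floor
`kappa₀ (4·2^{d₀}) (2d₀) ≤ R.u3.κ` that node N19′'s link reading `N19RateEdgeTube.rateEdge_of_linkReading_byName_pairDisc` (`hlink` :190) puts on node
U3's decay letter meets, at the N22 end, this lane's cap `hℓκ : ℓ.κ ≤ delta1 δ₀ κ (4M)` (J89 :219) — jointly they force `M ≤ 4` at the certified constants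
(`M ≤ 2` on J90's range; module J92).  READING: the floor is destructured as `hκ₀` (:289) and consumed at EXACTLY ONE place (:330), as the `hκ₀` argument
of knit v6 `N19MultiplicityByName.core_summable_of_ledgerAtSync_multByName`, which uses it (:229–234) ONLY to derive the (0.26)-type census
`∀ K, Multiplicity (L.All K) C.scale (fun X => Real.exp (-(κ * C.d X))) Cw vol Λg K` of the reference ledger from the TORUS-POLYMER census
`Spine.NE7.multiplicity_of_torusTreeDecay_sites` (⇐ (1.26) on the torus; this is where a lattice-animal threshold is genuinely needed) and to feed it
into knit v5 through the census ANTECEDENT of the ledger predicate `hL` (constants `Cw, Λg` FREE there).  At the objects of record the carrier is NOT a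
torus-polymer carrier: `(u3OfRecord₁₃ θ (objectsOfRecord₁₃ F N θ ℓ) k).C = U3OfKernels.carriers` (`rfl`), `Dom = ℕ × Fin 4 × Fin 4 × (Fin 4 → ℤ)`,
`scale (k, μ, ν, z) = k + 1`, `d (k, μ, ν, z) = |z|₁` — the TRANSLATION-REDUCED kernel indices of [I] (1.20)–(1.21) p. 264 (`z = x − x′`; the cube
count of (0.26) p. 257 is already divided out).  On such a carrier a scale-`j` slice of ANY finite ledger injects into `Fin 4 × Fin 4 × ℤ⁴`, so its census
is the plain lattice sum: `Σ_{X ∈ All K, scale X = j} e^{−κ·d X} ≤ 16 · K₁ 4 κ` FOR EVERY `κ > 0` — no animal threshold, no identification rows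
`Pf d₀ L₀ Koff cells hdom hinj hlen`, no volume growth (`Λ = 1`).

WHAT THIS FILE PROVES.
* §1 [folklore] TRANSLATION-REDUCED CENSUS: a finset injectively labelled by `ℤᵈ` has `Σ e^{−κ|z|₁} ≤ K₁ d κ` (`sum_exp_neg_l1_le_K₁`); injectively
  labelled by `γ × ℤᵈ` with `γ` finite, `≤ |γ| · K₁ d κ` (`sum_exp_neg_l1_le_card_mul_K₁`).
* §2 AT THE KERNEL CARRIER: `sliceSum_kernelCarriers_le` (every scale slice of every finite ledger: `≤ 16 · K₁ 4 κ`), `sliceSum_kernelCarriers_le_pow`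
  (numeric face `≤ 16 · ((1 + e^{−κ}) ∕ (1 − e^{−κ}))⁴ ≤ 16 · (1 + 2∕κ)⁴` by the tree's `K₁_eq_pow ∕ K₁_le_pow`; e.g. `≈ 16 · 278` at `κ = ½`, `16 · (1 + O(e^{−325}))`
  at the census floor value `κ₀(64, 8) ≈ 325.6`); ★ `multiplicity_kernelCarriers` (`0 < κ → 1 ≤ vol → 1 ≤ Λ → Multiplicity fac carriers.scale (e^{−κ·d})
  (16·K₁ 4 κ) vol Λ K`); `multiplicity_kernelCarriers_of_pos_vol` (`Cw := 16·K₁ 4 κ ∕ vol`).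
* §3 ★★ AT THE OBJECTS OF RECORD: `multiplicity_u3OfRecord₁₃_objectsOfRecord₁₃` — the census antecedent of `hL` VERBATIM (`N19RateEdgeTube` :176 = dag-n27-c's
  K3⁸ leaf `…MembersOfLemma2Records` :313) at `R.u3 := u3OfRecord₁₃ θ (objectsOfRecord₁₃ F N θ ℓ) k`, from `0 < ℓ.κ` (a (D4) row already on the bill),
  `1 ≤ vol`, `1 ≤ Λg`; `multiplicity_u3OfRecord₁₃_of_pin` — the same for any object tower `u` PINNED to the objects of record (`u = objectsOfRecord₁₃ …`,
  the shape of the leaf's pin :130).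
* §4 `multiplicity_u3OfRecord₁₃_objectsOfRecord₁₃_at_delta1` — in particular at J89's cap VALUE `ℓ.κ = delta1 δ₀ κ (4M)` (J90 ∕ J93's witnesses) the
  census holds for EVERY `M ≥ 1`: №276's located size is an artefact of ROUTING the kernel-carrier census through the polymer census, not a constraint of
  the letters.

WHAT IT BUYS (planner's call; none of it typed here).  Repair r4 of №276: (i) an N19 edge edition with the census DISPLAYED at free `(Cw₀, Λ₀)` in place of
rows :188–194 and the floor :190 (knit v5 `core_summable_of_ledgerAtSync_sizeByName` + `N19MultiplicityByName` §1 glue) — node N19's lanes; (ii) dag-n27-c's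
`hlinkBareV` re-plumbed on it, its rows `hκ₀` :138, `Koff cells` :299 and (m) :323–326 discharged by `exact` §3 at the pin — five displayed K3⁸ rows fewer;
(iii) J89 ∕ J90 ∕ J93 UNCHANGED (the floor was never a J89 row).

HONEST FRAMING (binding).  A lattice-sum certificate on def-W1's kernel objects and a first-hand reading with locators.  Nothing of Bałaban's is asserted,
instantiated or denied; NOT an N19 edition, NOT a re-key (DO-NOT-REKEY №265–269 respected); WHICH finite ledger `All K` the record's link reading names
stays NODE O's; N22 is NOT discharged; K3⁸ `SpineGivenEndpointR13SepCoPHV` OPEN; DISCHARGED count UNMOVED (8∕27, A 8∕28); one finite 𝕋⁴ programme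
at fixed ε — NOT infinite volume, NOT OS on ℝ⁴, NOT a mass gap, NOT Clay.

CITATION HEADER (LOCATIONS only; pages as printed).  [Balaban1987RG1] T. Bałaban, Comm. Math. Phys. 109 (1987) 249–301: (0.24)–(0.26) p. 257 (localization
domains, tree length, the census per cube), (1.20)–(1.21) p. 264 (the translation-reduced kernels), (5.10) p. 293 (`δ₁ = ½ min{δ₀, κM⁻¹}`);
[Balaban1988RG2Cluster] Comm. Math. Phys. 116 (1988) 1–22: (1.26) p. 9 (tree decay), (2.13)–(2.14) pp. 14–15 (the history terms = object W1).
-/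

set_option autoImplicit false

noncomputable section

open Finset
open scoped BigOperators

namespace YMDAG.N22.KernelFading

open Literature.MathematicalPhysics.QuantumFieldTheory.Balaban1983to89
open Literature.MathematicalPhysics.QuantumFieldTheory.Balaban1983to89.T4Continuum (T4Family)
open Literature.MathematicalPhysics.QuantumFieldTheory.Balaban1983to89.T4RecentScale (Multiplicity)
open Literature.MathematicalPhysics.QuantumFieldTheory.Balaban1983to89.B12Sec2to5 (l1 summable_exp_neg_l1)
open Literature.MathematicalPhysics.QuantumFieldTheory.Balaban1983to89.B12Decay510Window (K₁ K₁_nonneg)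
open Literature.MathematicalPhysics.QuantumFieldTheory.Balaban1983to89.Beta.RemainderConstNumerals (K₁_eq_pow K₁_le_pow)
open Literature.MathematicalPhysics.QuantumFieldTheory.Balaban1983to89.B12Decay510 (delta1 delta1_pos)
open Literature.MathematicalPhysics.QuantumFieldTheory.Balaban1983to89.Node00 (Stage13Params U3Letters₁₁ U3Objects₁₁)
open Literature.MathematicalPhysics.QuantumFieldTheory.Balaban1983to89.Node00.U3OfKernels (carriers objectsOfRecord₁₃)
open YMDAG.UVSplit (u3OfRecord₁₃)

/-! ## §1 Translation-reduced census: finsets injectively labelled by `ℤᵈ` (times a finite colour) [folklore] -/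

section Reduced

variable {D : Type*} {d : ℕ}

/-- A finset injectively labelled by lattice vectors has `Σ_{X} e^{−κ|z(X)|₁} ≤ K₁ d κ` for every `κ > 0` (`Summable.sum_le_tsum` on
`B12Sec2to5.summable_exp_neg_l1`). [folklore] -/
theorem sum_exp_neg_l1_le_K₁ (s : Finset D) (zOf : D → (Fin d → ℤ)) {κ : ℝ} (hκ : 0 < κ) (hinj : Set.InjOn zOf ↑s) :
    ∑ X ∈ s, Real.exp (-(κ * l1 (zOf X))) ≤ K₁ d κ := by
  have hs := summable_exp_neg_l1 hκ d
  calc ∑ X ∈ s, Real.exp (-(κ * l1 (zOf X))) = ∑ z ∈ s.image zOf, Real.exp (-κ * l1 z) := by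
        rw [Finset.sum_image fun x hx y hy h => hinj hx hy h]
        simp only [neg_mul]
    _ ≤ ∑' z : Fin d → ℤ, Real.exp (-κ * l1 z) := hs.sum_le_tsum _ fun z _ => (Real.exp_pos _).le
    _ = K₁ d κ := rfl

/-- A finset injectively labelled by `γ × ℤᵈ` with `γ` finite has `Σ_{X} e^{−κ|z(X)|₁} ≤ |γ| · K₁ d κ` for every `κ > 0` (sum fibrewise over the
colour; each fibre is injectively labelled by `ℤᵈ`). [folklore] -/
theorem sum_exp_neg_l1_le_card_mul_K₁ {γ : Type*} [Fintype γ] [DecidableEq γ] (s : Finset D) (col : D → γ)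
    (zOf : D → (Fin d → ℤ)) {κ : ℝ} (hκ : 0 < κ) (hinj : Set.InjOn (fun X => (col X, zOf X)) ↑s) :
    ∑ X ∈ s, Real.exp (-(κ * l1 (zOf X))) ≤ Fintype.card γ * K₁ d κ := by
  rw [← Finset.sum_fiberwise s col (fun X => Real.exp (-(κ * l1 (zOf X))))]
  calc ∑ c, ∑ X ∈ s with col X = c, Real.exp (-(κ * l1 (zOf X))) ≤ ∑ _c : γ, K₁ d κ :=
        Finset.sum_le_sum fun c _ => sum_exp_neg_l1_le_K₁ _ zOf hκ fun X hX Y hY h => by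
          rw [Finset.coe_filter] at hX hY
          exact hinj hX.1 hY.1 (Prod.ext (hX.2.trans hY.2.symm) h)
    _ = Fintype.card γ * K₁ d κ := by rw [Finset.sum_const, Finset.card_univ, nsmul_eq_mul]

end Reduced

/-! ## §2 At NODE 00's kernel carrier `U3OfKernels.carriers` (`Dom = ℕ × Fin 4 × Fin 4 × (Fin 4 → ℤ)`, `scale = (·).1 + 1`, `d = |z|₁`) -/

section KernelCarrier

/-- **EVERY SCALE SLICE OF EVERY FINITE LEDGER ON THE KERNEL CARRIER HAS CENSUS `≤ 16 · K₁ 4 κ`** for every `κ > 0`: on the slice `scale X = j` the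
map `X = (k, μ, ν, z) ↦ ((μ, ν), z)` is injective (`k = j − 1` is fixed), so §1 applies with `|Fin 4 × Fin 4| = 16`.  No animal threshold, no volume. [folklore] -/
theorem sliceSum_kernelCarriers_le (fac : Finset carriers.Dom) {κ : ℝ} (hκ : 0 < κ) (j : ℕ) :
    ∑ X ∈ fac with carriers.scale X = j, Real.exp (-(κ * carriers.d X)) ≤ 16 * K₁ 4 κ := by
  have hinj : Set.InjOn (fun X : carriers.Dom => ((X.2.1, X.2.2.1), X.2.2.2)) ↑(fac.filter fun X => carriers.scale X = j) := by
    rintro ⟨k, μ, ν, z⟩ hX ⟨k', μ', ν', z'⟩ hY hXY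
    rw [Finset.coe_filter] at hX hY
    simp only [Prod.mk.injEq] at hXY
    obtain ⟨⟨rfl, rfl⟩, rfl⟩ := hXY
    have hk : k + 1 = j := hX.2
    have hk' : k' + 1 = j := hY.2
    obtain rfl : k = k' := by omega
    rfl
  have h := sum_exp_neg_l1_le_card_mul_K₁ (fac.filter fun X => carriers.scale X = j)
    (fun X : carriers.Dom => (X.2.1, X.2.2.1)) (fun X => X.2.2.2) hκ hinj
  calc ∑ X ∈ fac with carriers.scale X = j, Real.exp (-(κ * carriers.d X))
      = ∑ X ∈ fac with carriers.scale X = j, Real.exp (-(κ * l1 X.2.2.2)) := rfl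
    _ ≤ Fintype.card (Fin 4 × Fin 4) * K₁ 4 κ := h
    _ = 16 * K₁ 4 κ := by norm_num [Fintype.card_prod, Fintype.card_fin]

/-- Numeric face of the slice census: `≤ 16 · ((1 + e^{−κ}) ∕ (1 − e^{−κ}))⁴` and `≤ 16 · (1 + 2∕κ)⁴` (the tree's closed form `K₁_eq_pow` and bound `K₁_le_pow`,
`Beta.RemainderConstNumerals`). [folklore] -/
theorem sliceSum_kernelCarriers_le_pow (fac : Finset carriers.Dom) {κ : ℝ} (hκ : 0 < κ) (j : ℕ) :
    ∑ X ∈ fac with carriers.scale X = j, Real.exp (-(κ * carriers.d X)) ≤ 16 * ((1 + Real.exp (-κ)) / (1 - Real.exp (-κ))) ^ 4 ∧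
      ∑ X ∈ fac with carriers.scale X = j, Real.exp (-(κ * carriers.d X)) ≤ 16 * (1 + 2 / κ) ^ 4 := by
  have h := sliceSum_kernelCarriers_le fac hκ j
  exact ⟨(K₁_eq_pow hκ 4) ▸ h, h.trans (mul_le_mul_of_nonneg_left (K₁_le_pow hκ 4) (by norm_num))⟩

/-- **THE (0.26) CENSUS ON THE KERNEL CARRIER, FLOOR-FREE** [bookkeeping]: for every `κ > 0`, every finite ledger `fac`, every cutoff `K`, volume letter
`vol ≥ 1` and growth letter `Λ ≥ 1`: `Multiplicity fac carriers.scale (X ↦ e^{−κ·d X}) (16 · K₁ 4 κ) vol Λ K` (`T4RecentScale.Multiplicity`: every scale-`j`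
slice weighs `≤ Cw · vol · Λ^{K−j}`).  On the torus-polymer carriers this needs `κ ≥ κ₀(4·2^d, 2d)` and the identification (m)
(`N19MultiplicityByName.multiplicity_of_torusCensusFamily`); on the translation-reduced kernel carrier it needs NOTHING but `κ > 0`. [folklore] -/
theorem multiplicity_kernelCarriers {κ vol Λ : ℝ} (hκ : 0 < κ) (hvol : 1 ≤ vol) (hΛ : 1 ≤ Λ) (fac : Finset carriers.Dom) (K : ℕ) :
    Multiplicity fac carriers.scale (fun X => Real.exp (-(κ * carriers.d X))) (16 * K₁ 4 κ) vol Λ K := by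
  intro j _
  have h16 : 0 ≤ 16 * K₁ 4 κ := mul_nonneg (by norm_num) (K₁_nonneg 4 κ)
  calc ∑ X ∈ fac with carriers.scale X = j, Real.exp (-(κ * carriers.d X)) ≤ 16 * K₁ 4 κ := sliceSum_kernelCarriers_le fac hκ j
    _ = 16 * K₁ 4 κ * 1 * 1 := by ring
    _ ≤ 16 * K₁ 4 κ * vol * Λ ^ (K - j) :=
        mul_le_mul (mul_le_mul_of_nonneg_left hvol h16) (one_le_pow₀ hΛ) zero_le_one (mul_nonneg h16 (zero_le_one.trans hvol))

/-- Variant with the volume letter only POSITIVE: `Cw := 16 · K₁ 4 κ ∕ vol` (then `Cw · vol · Λ^{K−j} = 16 · K₁ 4 κ · Λ^{K−j}`). [folklore] -/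
theorem multiplicity_kernelCarriers_of_pos_vol {κ vol Λ : ℝ} (hκ : 0 < κ) (hvol : 0 < vol) (hΛ : 1 ≤ Λ) (fac : Finset carriers.Dom) (K : ℕ) :
    Multiplicity fac carriers.scale (fun X => Real.exp (-(κ * carriers.d X))) (16 * K₁ 4 κ / vol) vol Λ K := by
  intro j _
  have h16 : 0 ≤ 16 * K₁ 4 κ := mul_nonneg (by norm_num) (K₁_nonneg 4 κ)
  have hne : vol ≠ 0 := hvol.ne'
  calc ∑ X ∈ fac with carriers.scale X = j, Real.exp (-(κ * carriers.d X)) ≤ 16 * K₁ 4 κ := sliceSum_kernelCarriers_le fac hκ j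
    _ = 16 * K₁ 4 κ * 1 := (mul_one _).symm
    _ ≤ 16 * K₁ 4 κ * Λ ^ (K - j) := mul_le_mul_of_nonneg_left (one_le_pow₀ hΛ) h16
    _ = 16 * K₁ 4 κ / vol * vol * Λ ^ (K - j) := by rw [div_mul_cancel₀ _ hne]

end KernelCarrier

/-! ## §3 At the objects of record (`u3OfRecord₁₃ θ (objectsOfRecord₁₃ F N θ ℓ) k`): the census antecedent of the ledger predicate, VERBATIM -/

section Record

variable {N : ℕ} [NeZero N]

/-- ★★ **THE CENSUS ANTECEDENT OF N19′'s LEDGER PREDICATE AT THE OBJECTS OF RECORD, FROM `0 < ℓ.κ` ALONE** [bookkeeping].  At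
`R.u3 := u3OfRecord₁₃ θ (objectsOfRecord₁₃ F N θ ℓ) k` the carrier `R.u3.C` IS the kernel carrier and `R.u3.κ` IS `ℓ.κ` (both `rfl`), so for every finite
ledger family `All`, every `vol ≥ 1`, `Λg ≥ 1`: `∀ K, Multiplicity (All K) R.u3.C.scale (fun X => Real.exp (-(R.u3.κ * R.u3.C.d X))) (16 · K₁ 4 ℓ.κ) vol Λg K` —
the shape of `N19RateEdgeTube.rateEdge_of_linkReading_byName_pairDisc`'s `hL` antecedent (:176) and of dag-n27-c's K3⁸ leaf (:313).  NO floor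
`κ₀(4·2^{d₀}, 2d₀) ≤ ℓ.κ`, NO identification rows (m).  NOT an N19 edition; N22 NOT discharged. [folklore] -/
theorem multiplicity_u3OfRecord₁₃_objectsOfRecord₁₃ (F : T4Family) (θ : Stage13Params F N) (ℓ : U3Letters₁₁) (k : ℕ) (hκ : 0 < ℓ.κ)
    {vol Λg : ℝ} (hvol : 1 ≤ vol) (hΛ : 1 ≤ Λg) (All : ℕ → Finset (u3OfRecord₁₃ θ (objectsOfRecord₁₃ F N θ ℓ) k).C.Dom) (K : ℕ) :
    Multiplicity (All K) (u3OfRecord₁₃ θ (objectsOfRecord₁₃ F N θ ℓ) k).C.scale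
      (fun X => Real.exp (-((u3OfRecord₁₃ θ (objectsOfRecord₁₃ F N θ ℓ) k).κ * (u3OfRecord₁₃ θ (objectsOfRecord₁₃ F N θ ℓ) k).C.d X)))
      (16 * K₁ 4 ℓ.κ) vol Λg K :=
  multiplicity_kernelCarriers hκ hvol hΛ (All K) K

/-- The same with the volume letter only positive (`Cw := 16 · K₁ 4 ℓ.κ ∕ vol`). [folklore] -/
theorem multiplicity_u3OfRecord₁₃_objectsOfRecord₁₃_of_pos_vol (F : T4Family) (θ : Stage13Params F N) (ℓ : U3Letters₁₁) (k : ℕ) (hκ : 0 < ℓ.κ)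
    {vol Λg : ℝ} (hvol : 0 < vol) (hΛ : 1 ≤ Λg) (All : ℕ → Finset (u3OfRecord₁₃ θ (objectsOfRecord₁₃ F N θ ℓ) k).C.Dom) (K : ℕ) :
    Multiplicity (All K) (u3OfRecord₁₃ θ (objectsOfRecord₁₃ F N θ ℓ) k).C.scale
      (fun X => Real.exp (-((u3OfRecord₁₃ θ (objectsOfRecord₁₃ F N θ ℓ) k).κ * (u3OfRecord₁₃ θ (objectsOfRecord₁₃ F N θ ℓ) k).C.d X)))
      (16 * K₁ 4 ℓ.κ / vol) vol Λg K :=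
  multiplicity_kernelCarriers_of_pos_vol hκ hvol hΛ (All K) K

/-- ★ **THE SAME UNDER A PIN** [bookkeeping]: for ANY object tower `u : U3Objects₁₁` pinned to the objects of record (`u = objectsOfRecord₁₃ F N θ ℓ` — the
shape of dag-n27-c's pin `(𝔯.lit F θ hP g₀ os).u3 = objectsOfRecord₁₃ …`, leaf :130) the census antecedent holds at `R.u3 := u3OfRecord₁₃ θ u k` with
`Cw = 16 · K₁ 4 ℓ.κ`, from `0 < ℓ.κ`, `1 ≤ vol`, `1 ≤ Λg`. [folklore] -/
theorem multiplicity_u3OfRecord₁₃_of_pin (F : T4Family) (θ : Stage13Params F N) (ℓ : U3Letters₁₁) {u : U3Objects₁₁}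
    (hu : u = objectsOfRecord₁₃ F N θ ℓ) (k : ℕ) (hκ : 0 < ℓ.κ) {vol Λg : ℝ} (hvol : 1 ≤ vol) (hΛ : 1 ≤ Λg)
    (All : ℕ → Finset (u3OfRecord₁₃ θ u k).C.Dom) (K : ℕ) :
    Multiplicity (All K) (u3OfRecord₁₃ θ u k).C.scale
      (fun X => Real.exp (-((u3OfRecord₁₃ θ u k).κ * (u3OfRecord₁₃ θ u k).C.d X))) (16 * K₁ 4 ℓ.κ) vol Λg K := by
  subst hu
  exact multiplicity_u3OfRecord₁₃_objectsOfRecord₁₃ F θ ℓ k hκ hvol hΛ All K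

/-! ## §4 In particular at J89's cap value `ℓ.κ = delta1 δ₀ κ (4M)` — for EVERY block count `M ≥ 1` -/

/-- **№276's LOCATED SIZE IS A ROUTING ARTEFACT** [bookkeeping]: at the letter value of J90 ∕ J93's witnesses, `ℓ.κ = delta1 δ₀ κ (4M)` (= (5.10)'s example
rate `½ min{δ₀, κ(4M)⁻¹}` of [I] p. 293, the cap of J89's row `hℓκ`), the census antecedent at the objects of record holds for EVERY `M ≥ 1`, `δ₀ > 0`,
`κ > 0` — whereas through node N19′'s floor on the same slot it held only for `M ≤ 4` at the certified constants (J92 §2).  Nothing re-keyed. [folklore] -/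
theorem multiplicity_u3OfRecord₁₃_objectsOfRecord₁₃_at_delta1 (F : T4Family) (θ : Stage13Params F N) (ℓ : U3Letters₁₁) (k : ℕ)
    {δ₀ κ M : ℝ} (hδ₀ : 0 < δ₀) (hκ : 0 < κ) (hM : 1 ≤ M) (hℓκ : ℓ.κ = delta1 δ₀ κ (M * 4))
    {vol Λg : ℝ} (hvol : 1 ≤ vol) (hΛ : 1 ≤ Λg) (All : ℕ → Finset (u3OfRecord₁₃ θ (objectsOfRecord₁₃ F N θ ℓ) k).C.Dom) (K : ℕ) :
    Multiplicity (All K) (u3OfRecord₁₃ θ (objectsOfRecord₁₃ F N θ ℓ) k).C.scale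
      (fun X => Real.exp (-((u3OfRecord₁₃ θ (objectsOfRecord₁₃ F N θ ℓ) k).κ * (u3OfRecord₁₃ θ (objectsOfRecord₁₃ F N θ ℓ) k).C.d X)))
      (16 * K₁ 4 (delta1 δ₀ κ (M * 4))) vol Λg K := by
  have hpos : 0 < ℓ.κ := hℓκ ▸ delta1_pos hδ₀ hκ (by linarith)
  rw [← hℓκ]
  exact multiplicity_u3OfRecord₁₃_objectsOfRecord₁₃ F θ ℓ k hpos hvol hΛ All K

end Record

end YMDAG.N22.KernelFading

end
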